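import Literature.Analysis.FluidPDE.LocalLerayPressureDecomposition
import Literature.Analysis.FluidPDE.LocalPressureFarFieldTools
import Literature.Analysis.FluidPDE.LerayPressureDecay
import Literature.Analysis.FluidPDE.NormalisedPressureLpBound
import HarnessLib

/-!
# The decay of the gauged pressure of a local Leray solution (Dp) from the local pressure
expansion (Kang–Miura–Tsai 2021, Lemma 3.4) and the Calderón–Zygmund bound (Stein 1970)

Analysis/FluidPDE proof file (theorems only) closing the DAG below the named fact **Dp**
`Literature.Analysis.FluidPDE.leray_solution_pressure_decay` (`LerayPressureDecay.lean`): for a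
weakly divergence-free `u₀ ∈ L³(ℝ³)` and a local Leray solution `(v, π)` with datum `u₀`
(`IsLocalLeraySolution 1 u₀ v π`, Kang–Miura–Tsai Def. 3.2) there are gauges
`c x₀ ∈ L^{3/2}(0,T)` with `∫₀ᵀ ∫_{B_{3/2}(x₀)} |π - c x₀(t)|^{3/2} → 0` as `|x₀| → ∞`, for every
`T > 0`. Main results:

* `leray_solution_pressure_decay_of_decomposition :
    kangMiuraTsai_pressure_decomposition → stein1970_normalisedPressure_ae_Lp_bound →
    leray_solution_pressure_decay` (**PD → CZ → Dp**);
* `leray_solution_farField_bound_of_decomposition :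
    lemarieRieusset_epsilon_regularity → kangMiuraTsai_pressure_decomposition →
    stein1970_normalisedPressure_ae_Lp_bound → leray_solution_farField_bound`
  (with the tree's `leray_solution_farField_bound_of_pressure_decay`), so that the far-field
  regularity **F** of local Leray solutions now rests on three printed theorems: the CKN
  ε-regularity criterion (Lemarié-Rieusset Thm. 14.4), the local pressure expansion (KMT
  Lemma 3.4) and Stein's `L^p` theory of the Riesz transforms (Ch. II Thms. 3–4);
* `stein1970_normalisedPressure_Lp_bound_of_ae : stein1970_normalisedPressure_ae_Lp_bound →
    stein1970_normalisedPressure_Lp_bound` — the bridge to the tree's smooth-class fact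
  (`NormalisedPressureLpBound.lean`), so that one discharge serves both.

## The proof (Kang–Miura–Tsai 2021, Lemma 3.3 = Kikuchi–Seregin 2007, Lemma 2.2, the term
`δ_R`, in the soft form that suffices for decay)

The printed decay estimate bounds `δ_R(T) = sup_{x₀} ∫₀ᵀ∫_{B_{3/2}(x₀)} |χ_R(p - c_{x₀})|^{3/2}`
by a Gronwall argument on the local energy inequality. For the *limit* `→ 0` along
`|x₀| → ∞` (all that **Dp** asserts) the Gronwall step is not needed, because the tree's class
(KMT Def. 3.2) carries Jia–Šverák's decay (7) `∫₀^{R²}∫_{B_R(x₀)} |v|² → 0` as an axiom and the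
decay of the cubic functional `∫₀ᵀ∫_{B_ρ(x₀)} |v|³ → 0` is already a theorem
(`IsLocalLeraySolution.tendsto_lintegral_cube_cocompact`). With `r = 3/2` in the expansion
`π - c_{x₀}(t) = π_loc + π_far` on `(0,T) × B_r(x₀)` (**PD**):

1. *Gauge.* `c x₀ (t) := ⨍_{B_r(x₀)} (π - π_loc - π_far)(t,x) dx` does not depend on `T` and agrees
   a.e. on `(0,T)` with the gauge `c_{x₀,r,T} ∈ L^{3/2}(0,T)` of **PD** (the integrand is a.e.
   constant in `x`), so `c x₀ ∈ L^{3/2}(0,T)` for every `T` and `π - c x₀ = π_loc + π_far` a.e.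
2. *Near field.* For a.e. `t`, `‖π_loc(t)‖^{3/2}_{L^{3/2}(ℝ³)} ≤ C ∫_{B_{2r}(x₀)} |v(t)|³` by **CZ**
   applied to `w = 1_{B_{2r}(x₀)} v(t)` (`|w|² ∈ L^{3/2}` for a.e. `t`); integrating in `t`,
   `∫₀ᵀ∫ |π_loc|^{3/2} ≤ C ∫₀ᵀ∫_{B_{2r}(x₀)} |v|³ → 0`.
3. *Far field.* For `x ∈ B_r(x₀)`, `|π_far(t,x)| ≤ C_K r ∫_{|y-x₀|≥2r} |v(t,y)|² |y-x₀|⁻⁴ dy`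
   (two-centre kernel bound, `exists_abs_pressureKernel_sub_le`). Split the integral at a
   radius `ρ ≥ 2r`: the part over `2r ≤ |y-x₀| < ρ` is `≤ (2r)⁻⁴ ∫_{B_ρ(x₀)} |v(t)|²`, whose
   `3/2`-th power integrates in time to `≤ C(ρ) ∫₀ᵀ∫_{B_ρ(x₀)} |v|² → 0` by (2) and (7); the part
   over `|y-x₀| ≥ ρ` is `≤ |B_1|⁻¹ A · 16 ∫_{|z|≥ρ-1} |z|⁻⁴ dz` uniformly in `x₀` and `t`
   (`lintegral_mul_le_of_forall_lintegral_ball_le`, `A` the uniform unit-ball energy bound of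
   (2)), which is small for `ρ` large (`tendsto_lintegral_compl_ball_powKer_four_atTop`).
4. *Assembly.* `∫₀ᵀ∫_{B_r(x₀)} |π - c x₀|^{3/2} ≤ α G₃(x₀) + β(ρ) E_ρ(x₀) + γ(ρ) T` for every `x₀`
   and `ρ`, with `G₃, E_ρ → 0` as `|x₀| → ∞` and `γ(ρ) → 0` as `ρ → ∞`: given `ε > 0` choose `ρ`,
   then `x₀` large.

## Mathlib / tree search

Tree: `kangMiuraTsai_pressure_decomposition`, `stein1970_normalisedPressure_ae_Lp_bound`,
`localPressureNear`, `localPressureFar` (`LocalLerayPressureDecomposition.lean`);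
`exists_abs_pressureKernel_sub_le`, `lintegral_mul_le_of_forall_lintegral_ball_le`,
`powKer_four_le_of_dist_lt_one`, `setLIntegral_compl_ball_comp_sub`,
`tendsto_lintegral_compl_ball_powKer_four_atTop` (`LocalPressureFarFieldTools.lean`);
`IsLocalLeraySolution.tendsto_lintegral_cube_cocompact` (`LerayVelocityCubicDecay.lean`);
`memE2_of_memLp` (`LocalLerayExistence.lean`); `leray_solution_farField_bound_of_pressure_decay`
(`LerayPressureDecay.lean`). Mathlib: `Measure.ae_ae_of_ae_prod`, `lintegral_prod`,
`AEStronglyMeasurable.prodMk_left`, `setAverage_const`, `average_congr`, `MemLp.ae_eq`,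
`ENNReal.rpow_add_le_mul_rpow_add_rpow`, `ENNReal.tendsto_nhds_zero`, `ENNReal.add_thirds`.

## References

* K. Kang, H. Miura, T.-P. Tsai, IMRN 2021 = arXiv:1812.10509, §3 Lemma 3.3 (the term `δ_R`),
  Lemma 3.4, §8 (the bounds on `p_loc`, `p_far`). Bib key `KangMiuraTsai2020`.
* N. Kikuchi, G. Seregin, AMS Transl. (2) 220 (2007), Lemma 2.2. Bib key `KikuchiSeregin2007`.
* E. M. Stein, *Singular integrals* (1970), Ch. II §4.2 Thm. 3, §4.5 Thm. 4. Bib key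
  `Stein1971`.
* Z. Bradshaw, T.-P. Tsai, Comm. PDE 45 (2020) = arXiv:1907.00256, end of §1 (the decay
  display). Bib key `BradshawTsai2020`.
-/

noncomputable section

open _root_.MeasureTheory _root_.TopologicalSpace _root_.Metric _root_.Filter _root_.Set
  _root_.Function
open scoped _root_.ENNReal _root_.NNReal _root_.Topology

namespace Literature.Analysis.FluidPDE

/-! ## Tools: `L^{3/2}` bookkeeping -/

section Tools

variable {α : Type*} [MeasurableSpace α] {F : Type*} [NormedAddCommGroup F]

/-- `∫ ‖f‖^{3/2} = ‖f‖_{L^{3/2}}^{3/2}` (the three numerical facts `3/2 ≠ 0, ∞`,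
`(3/2).toReal = 3/2` are inlined). [folklore] -/
theorem lintegral_rpow_threeHalves_eq (f : α → F) (μ : Measure α) :
    ∫⁻ x, ‖f x‖ₑ ^ (3 / 2 : ℝ) ∂μ = eLpNorm f (3 / 2 : ℝ≥0∞) μ ^ (3 / 2 : ℝ) := by
  have h0 : (3 / 2 : ℝ≥0∞) ≠ 0 := (ENNReal.div_pos (by norm_num) (by norm_num)).ne'
  have ht : (3 / 2 : ℝ≥0∞) ≠ ⊤ := ENNReal.div_ne_top (by norm_num) (by norm_num)
  have hr : ((3 / 2 : ℝ≥0∞)).toReal = 3 / 2 := by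
    rw [ENNReal.toReal_div, ENNReal.toReal_ofNat, ENNReal.toReal_ofNat]
  rw [eLpNorm_eq_lintegral_rpow_enorm_toReal h0 ht, hr, ← ENNReal.rpow_mul]
  norm_num

/-- Finiteness transfer: `‖f‖_{L^{3/2}} < ∞` when `∫ ‖f‖^{3/2} < ∞`. [folklore] -/
theorem eLpNorm_threeHalves_lt_top_of_lintegral {f : α → F} {μ : Measure α}
    (h : ∫⁻ x, ‖f x‖ₑ ^ (3 / 2 : ℝ) ∂μ ≠ ⊤) : eLpNorm f (3 / 2 : ℝ≥0∞) μ < ⊤ := by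
  have h0 : (3 / 2 : ℝ≥0∞) ≠ 0 := (ENNReal.div_pos (by norm_num) (by norm_num)).ne'
  have ht : (3 / 2 : ℝ≥0∞) ≠ ⊤ := ENNReal.div_ne_top (by norm_num) (by norm_num)
  have hr : ((3 / 2 : ℝ≥0∞)).toReal = 3 / 2 := by
    rw [ENNReal.toReal_div, ENNReal.toReal_ofNat, ENNReal.toReal_ofNat]
  rw [eLpNorm_eq_lintegral_rpow_enorm_toReal h0 ht, hr]
  exact ENNReal.rpow_lt_top_of_nonneg (by norm_num) h

/-- `‖ |a|² ‖ₑ^{3/2} = ‖a‖ₑ³`. [folklore] -/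
theorem enorm_norm_sq_rpow_threeHalves (a : F) :
    ‖(‖a‖ ^ 2 : ℝ)‖ₑ ^ (3 / 2 : ℝ) = ‖a‖ₑ ^ (3 : ℕ) := by
  rw [Real.enorm_eq_ofReal (sq_nonneg _), ENNReal.ofReal_pow (norm_nonneg _),
    ofReal_norm, ← ENNReal.rpow_natCast _ 2, ← ENNReal.rpow_mul,
    ← ENNReal.rpow_natCast _ 3]
  norm_num

/-- `(a + b)^{3/2} ≤ √2 (a^{3/2} + b^{3/2})` in `ℝ≥0∞`. [folklore] -/
theorem add_rpow_threeHalves_le (a b : ℝ≥0∞) :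
    (a + b) ^ (3 / 2 : ℝ) ≤ (2 : ℝ≥0∞) ^ (1 / 2 : ℝ) * (a ^ (3 / 2 : ℝ) + b ^ (3 / 2 : ℝ)) := by
  have h := ENNReal.rpow_add_le_mul_rpow_add_rpow a b (by norm_num : (1 : ℝ) ≤ 3 / 2)
  norm_num at h
  exact h

/-- `x^{3/2} = x^{1/2} x`. [folklore] -/
theorem rpow_threeHalves_eq_sqrt_mul (x : ℝ≥0∞) : x ^ (3 / 2 : ℝ) = x ^ (1 / 2 : ℝ) * x := by
  conv_rhs => rw [← ENNReal.rpow_one x]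
  rw [← ENNReal.rpow_mul, ← ENNReal.rpow_add_of_nonneg _ _ (by norm_num) (by norm_num)]
  norm_num

end Tools

/-! ## The near field: the Calderón–Zygmund bound slice by slice -/

/-- **Near-field slice bound.** Under **CZ** there is a finite constant `C > 0` such that for
every centre `x₀`, radius `r`, field `v` and time `t` with `v(t)` measurable and
`∫_{B_{2r}(x₀)} |v(t)|³ < ∞`,
`∫ |π_loc(t,x)|^{3/2} dx ≤ C ∫_{B_{2r}(x₀)} |v(t)|³` (`π_loc = p̃[1_{B_{2r}(x₀)} v(t)]`,
`‖p̃[w]‖_{3/2} ≤ C_{3/2} ‖|w|²‖_{3/2}`, raised to the power `3/2`; Kang–Miura–Tsai 2021, §8: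
"`∫_{B_{3R/2}(x₀)} |p_loc|^q ≤ c_q ∫_{B_{3R}(x₀)} |v|^{2q}`").
[cite: KangMiuraTsai2020, §8 proof of Lemma 3.4 (Calderón–Zygmund estimate for p_loc), arXiv:1812.10509 p. 18] -/
theorem exists_lintegral_localPressureNear_le (hCZ : stein1970_normalisedPressure_ae_Lp_bound) :
    ∃ C : ℝ≥0∞, C ≠ 0 ∧ C ≠ ⊤ ∧
      ∀ (x₀ : EuclideanSpace ℝ (Fin 3)) (r : ℝ)
        (v : ℝ → EuclideanSpace ℝ (Fin 3) → EuclideanSpace ℝ (Fin 3)) (t : ℝ),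
        AEStronglyMeasurable (v t) volume →
        ∫⁻ x in ball x₀ (2 * r), ‖v t x‖ₑ ^ (3 : ℕ) ≠ ⊤ →
          ∫⁻ x, ‖localPressureNear x₀ r v t x‖ₑ ^ (3 / 2 : ℝ) ≤
            C * ∫⁻ x in ball x₀ (2 * r), ‖v t x‖ₑ ^ (3 : ℕ) := by
  obtain ⟨C, hC⟩ := hCZ (3 / 2)
    ((ENNReal.lt_div_iff_mul_lt (Or.inl two_ne_zero) (Or.inl ENNReal.ofNat_ne_top)).2
      (by norm_num))
    (lt_top_iff_ne_top.2 (ENNReal.div_ne_top (by norm_num) (by norm_num)))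
  set C' : ℝ≥0∞ := max (C : ℝ≥0∞) 1 with hC'
  have hC'top : C' ≠ ⊤ := by simp [hC']
  have hC'1 : 1 ≤ C' := le_max_right _ _
  refine ⟨C' ^ (3 / 2 : ℝ), ?_, ENNReal.rpow_ne_top_of_nonneg (by norm_num) hC'top,
    fun x₀ r v t hvt hfin => ?_⟩
  · exact (ENNReal.rpow_pos (lt_of_lt_of_le zero_lt_one hC'1) hC'top).ne'
  set w : EuclideanSpace ℝ (Fin 3) → EuclideanSpace ℝ (Fin 3) :=
    (ball x₀ (2 * r)).indicator (v t) with hw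
  have hwm : AEStronglyMeasurable w volume := hvt.indicator measurableSet_ball
  -- `‖ |w|² ‖ₑ^{3/2}` is the cut-off `|v(t)|³`
  have hpt : ∀ x, ‖(‖w x‖ ^ 2 : ℝ)‖ₑ ^ (3 / 2 : ℝ) =
      (ball x₀ (2 * r)).indicator (fun x => ‖v t x‖ₑ ^ (3 : ℕ)) x := by
    intro x
    rw [enorm_norm_sq_rpow_threeHalves, hw, enorm_indicator_eq_indicator_enorm]
    by_cases hx : x ∈ ball x₀ (2 * r)
    · simp [hx]
    · simp [hx]
  have hlin : ∫⁻ x, ‖(‖w x‖ ^ 2 : ℝ)‖ₑ ^ (3 / 2 : ℝ) =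
      ∫⁻ x in ball x₀ (2 * r), ‖v t x‖ₑ ^ (3 : ℕ) := by
    rw [← lintegral_indicator measurableSet_ball]
    exact lintegral_congr hpt
  have hsq_meas : AEStronglyMeasurable (fun x => ‖w x‖ ^ 2) volume :=
    (continuous_norm.pow 2).comp_aestronglyMeasurable hwm
  have hmem : MemLp (fun x => ‖w x‖ ^ 2) (3 / 2 : ℝ≥0∞) volume := by
    refine ⟨hsq_meas, eLpNorm_threeHalves_lt_top_of_lintegral ?_⟩
    rw [hlin]
    exact hfin
  obtain ⟨_, hbound⟩ := hC w hwm hmem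
  have h1 : ∫⁻ x, ‖localPressureNear x₀ r v t x‖ₑ ^ (3 / 2 : ℝ) =
      eLpNorm (normalisedPressure w) (3 / 2 : ℝ≥0∞) volume ^ (3 / 2 : ℝ) :=
    lintegral_rpow_threeHalves_eq (normalisedPressure w) volume
  have h2 : ∫⁻ x in ball x₀ (2 * r), ‖v t x‖ₑ ^ (3 : ℕ) =
      eLpNorm (fun x => ‖w x‖ ^ 2) (3 / 2 : ℝ≥0∞) volume ^ (3 / 2 : ℝ) := by
    rw [← hlin, lintegral_rpow_threeHalves_eq]
  rw [h1, h2]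
  calc eLpNorm (normalisedPressure w) (3 / 2 : ℝ≥0∞) volume ^ (3 / 2 : ℝ)
      ≤ ((C : ℝ≥0∞) * eLpNorm (fun x => ‖w x‖ ^ 2) (3 / 2 : ℝ≥0∞) volume) ^ (3 / 2 : ℝ) :=
        ENNReal.rpow_le_rpow hbound (by norm_num)
    _ ≤ (C' * eLpNorm (fun x => ‖w x‖ ^ 2) (3 / 2 : ℝ≥0∞) volume) ^ (3 / 2 : ℝ) := by
        gcongr
        exact le_max_left _ _
    _ = C' ^ (3 / 2 : ℝ) * eLpNorm (fun x => ‖w x‖ ^ 2) (3 / 2 : ℝ≥0∞) volume ^ (3 / 2 : ℝ) :=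
        ENNReal.mul_rpow_of_nonneg _ _ (by norm_num)

/-! ## The far field: the pointwise bound and the uniformly-local tail -/

/-- **Pointwise far-field bound** (Kang–Miura–Tsai 2021, §8: "`|p_far(x,t)| ≤
∫_{2R<|y-x₀|} cR|x₀-y|⁻⁴ |v(y,t)|² dy`"): with `C` a two-centre constant of the pressure kernel
(`exists_abs_pressureKernel_sub_le`), for `x ∈ B_r(x₀)`,
`‖π_far(t,x)‖ ≤ C r ∫_{|y-x₀| ≥ 2r} |v(t,y)|² |y-x₀|⁻⁴ dy` (as an extended real; no integrability
assumed). [cite: KangMiuraTsai2020, §8 proof of Lemma 3.4 (pointwise bound for p_far), arXiv:1812.10509 p. 18] -/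
theorem enorm_localPressureFar_le {C : ℝ} (hC0 : 0 ≤ C)
    (hC : ∀ x₀ x y a : EuclideanSpace ℝ (Fin 3), 2 * ‖x - x₀‖ ≤ ‖y - x₀‖ → y ≠ x₀ →
      |pressureKernel (x - y) a - pressureKernel (x₀ - y) a| ≤
        C * ‖x - x₀‖ * ‖a‖ ^ 2 / ‖y - x₀‖ ^ 4)
    (x₀ : EuclideanSpace ℝ (Fin 3)) {r : ℝ} (hr : 0 < r)
    (v : ℝ → EuclideanSpace ℝ (Fin 3) → EuclideanSpace ℝ (Fin 3)) (t : ℝ)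
    {x : EuclideanSpace ℝ (Fin 3)} (hx : x ∈ ball x₀ r) :
    ‖localPressureFar x₀ r v t x‖ₑ ≤ ENNReal.ofReal (C * r) *
      ∫⁻ y in (ball x₀ (2 * r))ᶜ, ‖v t y‖ₑ ^ (2 : ℕ) * RieszKernel.powKer 4 (y - x₀) := by
  rw [localPressureFar_apply]
  refine (enorm_integral_le_lintegral_enorm _).trans ?_
  rw [← lintegral_const_mul' _ _ ENNReal.ofReal_ne_top]
  refine setLIntegral_mono' measurableSet_ball.compl fun y hy => ?_
  have hyx₀ : 2 * r ≤ ‖y - x₀‖ := by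
    rw [mem_compl_iff, mem_ball, dist_eq_norm, not_lt] at hy
    exact hy
  have hxx₀ : ‖x - x₀‖ < r := by rwa [mem_ball, dist_eq_norm] at hx
  have hypos : 0 < ‖y - x₀‖ := by linarith
  have hy0 : y ≠ x₀ := fun h => by
    rw [h, sub_self, norm_zero] at hypos
    exact lt_irrefl _ hypos
  have h2 : 2 * ‖x - x₀‖ ≤ ‖y - x₀‖ := by linarith
  have hb := hC x₀ x y (v t y) h2 hy0
  rw [Real.enorm_eq_ofReal_abs, RieszKernel.powKer_apply, ← ofReal_norm,
    ← ENNReal.ofReal_pow (norm_nonneg _), ← ENNReal.ofReal_mul (by positivity),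
    ← ENNReal.ofReal_mul (by positivity)]
  refine ENNReal.ofReal_le_ofReal (hb.trans ?_)
  have e4 : ‖y - x₀‖ ^ (-4 : ℝ) = (‖y - x₀‖ ^ 4)⁻¹ := by
    rw [Real.rpow_neg hypos.le, show (4 : ℝ) = ((4 : ℕ) : ℝ) by norm_num, Real.rpow_natCast]
  rw [e4]
  calc C * ‖x - x₀‖ * ‖v t y‖ ^ 2 / ‖y - x₀‖ ^ 4
      = C * ‖x - x₀‖ * (‖v t y‖ ^ 2 * (‖y - x₀‖ ^ 4)⁻¹) := by ring
    _ ≤ C * r * (‖v t y‖ ^ 2 * (‖y - x₀‖ ^ 4)⁻¹) := by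
        gcongr

/-- **The uniformly-local tail** (the lattice sum "`Σ_{0≠k∈ℤ³} ∫_{B_R(x₀+Rk)} cR|Rk|⁻⁴|v|² ≤
c R⁻³ ‖v(t)‖²_{L²_{uloc,R}}`" of Kang–Miura–Tsai 2021, §8, in decaying form): if `g ≥ 0` has
unit-ball integrals `≤ A`, then for `ρ ≥ 2`,
`∫_{|y-x₀| ≥ ρ} g(y) |y-x₀|⁻⁴ dy ≤ |B_1|⁻¹ A · 16 ∫_{|z| ≥ ρ-1} |z|⁻⁴ dz`, uniformly in `x₀`.
[cite: KangMiuraTsai2020, §8 proof of Lemma 3.4 (bound for p_far by the uniformly local energy), arXiv:1812.10509 p. 18] -/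
theorem lintegral_compl_ball_mul_powKer_le {g : EuclideanSpace ℝ (Fin 3) → ℝ≥0∞}
    (hg : AEMeasurable g volume) {A : ℝ≥0∞}
    (hA : ∀ z : EuclideanSpace ℝ (Fin 3), ∫⁻ y in ball z 1, g y ≤ A)
    (x₀ : EuclideanSpace ℝ (Fin 3)) {ρ : ℝ} (hρ : 2 ≤ ρ) :
    ∫⁻ y in (ball x₀ ρ)ᶜ, g y * RieszKernel.powKer 4 (y - x₀) ≤
      (volume (ball (0 : EuclideanSpace ℝ (Fin 3)) 1))⁻¹ *
        (A * (16 * ∫⁻ z in (ball (0 : EuclideanSpace ℝ (Fin 3)) (ρ - 1))ᶜ,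
          RieszKernel.powKer 4 z)) := by
  set W : EuclideanSpace ℝ (Fin 3) → ℝ≥0∞ :=
    (ball x₀ ρ)ᶜ.indicator fun y => RieszKernel.powKer 4 (y - x₀) with hW
  set w : EuclideanSpace ℝ (Fin 3) → ℝ≥0∞ := fun z =>
    16 * (ball x₀ (ρ - 1))ᶜ.indicator (fun z => RieszKernel.powKer 4 (z - x₀)) z with hw
  have hwm : AEMeasurable w volume :=
    (((RieszKernel.measurable_powKer_sub 4 x₀).indicator
      measurableSet_ball.compl).const_mul 16).aemeasurable
  have h1 : ∫⁻ y in (ball x₀ ρ)ᶜ, g y * RieszKernel.powKer 4 (y - x₀) = ∫⁻ y, g y * W y := by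
    rw [← lintegral_indicator measurableSet_ball.compl]
    refine lintegral_congr fun y => ?_
    by_cases hy : y ∈ (ball x₀ ρ)ᶜ
    · rw [indicator_of_mem hy, hW, indicator_of_mem hy]
    · rw [indicator_of_notMem hy, hW, indicator_of_notMem hy, mul_zero]
  have h2 : ∫⁻ z, w z =
      16 * ∫⁻ z in (ball (0 : EuclideanSpace ℝ (Fin 3)) (ρ - 1))ᶜ, RieszKernel.powKer 4 z := by
    rw [hw, lintegral_const_mul' _ _ (by norm_num), lintegral_indicator measurableSet_ball.compl,
      setLIntegral_compl_ball_comp_sub (RieszKernel.powKer 4) x₀ (ρ - 1)]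
  rw [h1, ← h2]
  refine lintegral_mul_le_of_forall_lintegral_ball_le hg hwm hA fun y z hz => ?_
  by_cases hy : y ∈ (ball x₀ ρ)ᶜ
  · have hy' : ρ ≤ ‖y - x₀‖ := by
      rw [mem_compl_iff, mem_ball, dist_eq_norm, not_lt] at hy
      exact hy
    obtain ⟨hk, hzn⟩ := powKer_four_le_of_dist_lt_one hρ hy' hz
    have hz' : z ∈ (ball x₀ (ρ - 1))ᶜ := by
      rw [mem_compl_iff, mem_ball, dist_eq_norm, not_lt]
      exact hzn
    rw [hW, hw, indicator_of_mem hy]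
    dsimp only
    rw [indicator_of_mem hz']
    exact hk
  · rw [hW, indicator_of_notMem hy]
    exact zero_le

/-! ## Slices of a local Leray solution -/

section Slices

variable {ν : ℝ} {u₀ : EuclideanSpace ℝ (Fin 3) → EuclideanSpace ℝ (Fin 3)}
  {v : ℝ → EuclideanSpace ℝ (Fin 3) → EuclideanSpace ℝ (Fin 3)}
  {π : ℝ → EuclideanSpace ℝ (Fin 3) → ℝ}

/-- The open slab `(0,∞) × ℝ³` as a set. [folklore] -/
theorem coe_slab_Ioi :
    ((slab (EuclideanSpace ℝ (Fin 3)) (Ioi 0) isOpen_Ioi :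
      Opens (ℝ × EuclideanSpace ℝ (Fin 3))) : Set (ℝ × EuclideanSpace ℝ (Fin 3))) =
      Ioi (0 : ℝ) ×ˢ univ := rfl

/-- The pressure of a local Leray solution is measurable on the slab. [folklore] -/
theorem IsLocalLeraySolution.aestronglyMeasurable_pressure (hv : IsLocalLeraySolution ν u₀ v π) :
    AEStronglyMeasurable (uncurry π)
      (volume.restrict (Ioi (0 : ℝ) ×ˢ (univ : Set (EuclideanSpace ℝ (Fin 3))))) := by
  rw [← coe_slab_Ioi]
  exact hv.distributional.2.2.1.aestronglyMeasurable

/-- Almost every time slice of a local Leray solution is measurable. [folklore] -/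
theorem IsLocalLeraySolution.ae_aestronglyMeasurable_slice (hv : IsLocalLeraySolution ν u₀ v π)
    (T : ℝ) : ∀ᵐ t ∂(volume.restrict (Ioo 0 T)), AEStronglyMeasurable (v t) volume := by
  have h1 : AEStronglyMeasurable (uncurry v)
      ((volume.restrict (Ioi (0 : ℝ))).prod (volume : Measure (EuclideanSpace ℝ (Fin 3)))) := by
    have e : (volume.restrict (Ioi (0 : ℝ))).prod (volume : Measure (EuclideanSpace ℝ (Fin 3))) =
        volume.restrict (Ioi (0 : ℝ) ×ˢ (univ : Set (EuclideanSpace ℝ (Fin 3)))) := by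
      conv_lhs => rw [← Measure.restrict_univ (μ := (volume : Measure (EuclideanSpace ℝ (Fin 3))))]
      rw [Measure.prod_restrict, ← Measure.volume_eq_prod]
    rw [e]
    exact hv.aestronglyMeasurable
  have h2 := h1.prodMk_left
  exact ae_restrict_of_ae_restrict_of_subset Ioo_subset_Ioi_self h2

/-- The uniformly local energy bound (2) of Kang–Miura–Tsai Def. 3.2 on balls of a fixed radius
`ρ`, uniformly in the centre, for a.e. `t ∈ (0,T)` (from the bound at the radius
`R = max(ρ, T, 1)`, `R² ≥ T`). [cite: KangMiuraTsai2020, Def. 3.1 (2) / Def. 3.2, arXiv:1812.10509 p. 7] -/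
theorem IsLocalLeraySolution.exists_ae_lintegral_ball_le (hv : IsLocalLeraySolution ν u₀ v π)
    (T ρ : ℝ) :
    ∃ A : ℝ≥0, ∀ᵐ t ∂(volume.restrict (Ioo 0 T)), ∀ z : EuclideanSpace ℝ (Fin 3),
      ∫⁻ y in ball z ρ, ‖v t y‖ₑ ^ 2 ≤ A := by
  set R : ℝ := max ρ (max T 1) with hR
  have hR1 : 1 ≤ R := le_trans (le_max_right T 1) (le_max_right _ _)
  have hRpos : 0 < R := by linarith
  have hρR : ρ ≤ R := le_max_left _ _
  have hTR : T ≤ R ^ 2 := by nlinarith [le_trans (le_max_left T 1) (le_max_right ρ (max T 1))]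
  obtain ⟨A, hA⟩ := hv.uniformLocalEnergy R hRpos
  refine ⟨A, ?_⟩
  filter_upwards [ae_restrict_of_ae_restrict_of_subset (Ioo_subset_Ioo le_rfl hTR) hA] with t ht z
  exact (lintegral_mono_set (ball_subset_ball hρR)).trans (ht z)

end Slices

/-! ## The gauge -/

/-- **A `T`-independent gauge** (Bradshaw–Tsai 2020, Def. 1.1, footnote: "`c_{x₀,R}(t)` can
depend on `T'` in principle. This does not matter in practice"): under **PD**, for a local Leray
solution with `E²` datum and every centre `x₀` and radius `r > 0`, the ball average
`c(t) = ⨍_{B_r(x₀)} (π - π_loc - π_far)(t,x) dx` lies in `L^{3/2}(0,T)` for every `T > 0` and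
`π - c = π_loc + π_far` a.e. on `(0,T) × B_r(x₀)` for every `T > 0` (the integrand is a.e. equal
to the gauge `c_{x₀,r,T}(t)` of **PD**, a constant in `x`).
[cite: KangMiuraTsai2020, Lemma 3.4 (the gauge c_{x₀,r}), arXiv:1812.10509 p. 8] -/
theorem exists_gauge_of_pressure_decomposition (hPD : kangMiuraTsai_pressure_decomposition)
    {u₀ : EuclideanSpace ℝ (Fin 3) → EuclideanSpace ℝ (Fin 3)} (hE2 : MemE2 u₀)
    (hdiv : IsWeaklyDivFree u₀)
    {v : ℝ → EuclideanSpace ℝ (Fin 3) → EuclideanSpace ℝ (Fin 3)}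
    {π : ℝ → EuclideanSpace ℝ (Fin 3) → ℝ} (hv : IsLocalLeraySolution 1 u₀ v π)
    (x₀ : EuclideanSpace ℝ (Fin 3)) {r : ℝ} (hr : 0 < r) :
    ∃ c : ℝ → ℝ, ∀ T : ℝ, 0 < T →
      MemLp c (3 / 2 : ℝ≥0∞) (volume.restrict (Ioo 0 T)) ∧
      ∀ᵐ z ∂(volume.restrict (Ioo 0 T ×ˢ ball x₀ r)),
        π z.1 z.2 - c z.1 = localPressureNear x₀ r v z.1 z.2 + localPressureFar x₀ r v z.1 z.2 := by
  set N := localPressureNear x₀ r v with hN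
  set Fa := localPressureFar x₀ r v with hFa
  set B : Set (EuclideanSpace ℝ (Fin 3)) := ball x₀ r with hB
  refine ⟨fun t => ⨍ x in B, (π t x - N t x - Fa t x), fun T hT => ?_⟩
  obtain ⟨cT, hcT, hae⟩ := hPD u₀ hE2 hdiv v π hv x₀ r T hr hT
  set μt : Measure ℝ := volume.restrict (Ioo 0 T) with hμt
  set μB : Measure (EuclideanSpace ℝ (Fin 3)) := volume.restrict B with hμB
  have hprod : μt.prod μB = volume.restrict (Ioo 0 T ×ˢ B) := by
    rw [hμt, hμB, Measure.prod_restrict, ← Measure.volume_eq_prod]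
  have hB0 : volume B ≠ 0 := (measure_ball_pos volume x₀ hr).ne'
  have hBt : volume B ≠ ⊤ := measure_ball_lt_top.ne
  have hae' : ∀ᵐ z ∂μt.prod μB, π z.1 z.2 = N z.1 z.2 + Fa z.1 z.2 + cT z.1 := by
    rw [hprod]
    exact hae
  have hslice : ∀ᵐ t ∂μt, ∀ᵐ x ∂μB, π t x = N t x + Fa t x + cT t :=
    Measure.ae_ae_of_ae_prod hae'
  -- the average is `cT t` for a.e. `t`
  have hgauge : (fun t => ⨍ x in B, (π t x - N t x - Fa t x)) =ᵐ[μt] cT := by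
    filter_upwards [hslice] with t ht
    have h1 : (fun x => π t x - N t x - Fa t x) =ᵐ[μB] fun _ => cT t := by
      filter_upwards [ht] with x hx
      rw [hx]
      ring
    show ⨍ x, (π t x - N t x - Fa t x) ∂μB = cT t
    rw [average_congr h1, hμB]
    exact setAverage_const hB0 hBt _
  refine ⟨hcT.ae_eq hgauge.symm, ?_⟩
  have hfst : (fun z : ℝ × EuclideanSpace ℝ (Fin 3) => ⨍ x in B, (π z.1 x - N z.1 x - Fa z.1 x))
      =ᵐ[μt.prod μB] fun z => cT z.1 :=
    Measure.QuasiMeasurePreserving.ae_eq Measure.quasiMeasurePreserving_fst hgauge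
  rw [← hprod]
  filter_upwards [hae', hfst] with z h1 h2
  rw [h2, h1]
  ring

/-! ## The core estimate at one centre -/

/-- **The core estimate** (steps 2–4 of the module docstring at a fixed centre `x₀` and a
fixed splitting radius `ρ ≥ 3`, radius `r = 3/2`): if `π - c = π_loc + π_far` a.e. on
`(0,T) × B_{3/2}(x₀)` with `c` measurable, the unit-ball energies of `v(t)` are `≤ A` and the
`ρ`-ball energy at `x₀` is `≤ A₁` for a.e. `t ∈ (0,T)`, then
`∫₀ᵀ∫_{B_{3/2}(x₀)} |π - c|^{3/2} ≤ α ∫₀ᵀ∫_{B_3(x₀)} |v|³ + β ∫₀ᵀ∫_{B_ρ(x₀)} |v|² + γ |(0,T)|`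
with `α = √2 Cₙ`, `β = β(ρ)` finite and `γ = 2|B_{3/2}| (C_K r)^{3/2} Tail(ρ)^{3/2}`,
`Tail(ρ) = |B_1|⁻¹ A · 16 ∫_{|z| ≥ ρ-1} |z|⁻⁴` (Kang–Miura–Tsai 2021, §8, the bounds on `p_loc` and
`p_far`, integrated in time). [cite: KangMiuraTsai2020, §8 proof of Lemma 3.4 (bounds for p_loc and p_far), arXiv:1812.10509 p. 18] -/
theorem lintegral_gauged_pressure_le
    {Cn : ℝ≥0∞} (hCn0 : Cn ≠ 0) (hCntop : Cn ≠ ⊤)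
    (hnear : ∀ (x₀ : EuclideanSpace ℝ (Fin 3)) (r : ℝ)
        (v : ℝ → EuclideanSpace ℝ (Fin 3) → EuclideanSpace ℝ (Fin 3)) (t : ℝ),
        AEStronglyMeasurable (v t) volume →
        ∫⁻ x in ball x₀ (2 * r), ‖v t x‖ₑ ^ (3 : ℕ) ≠ ⊤ →
          ∫⁻ x, ‖localPressureNear x₀ r v t x‖ₑ ^ (3 / 2 : ℝ) ≤
            Cn * ∫⁻ x in ball x₀ (2 * r), ‖v t x‖ₑ ^ (3 : ℕ))
    {CK : ℝ} (hCK0 : 0 ≤ CK)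
    (hCK : ∀ x₀ x y a : EuclideanSpace ℝ (Fin 3), 2 * ‖x - x₀‖ ≤ ‖y - x₀‖ → y ≠ x₀ →
      |pressureKernel (x - y) a - pressureKernel (x₀ - y) a| ≤
        CK * ‖x - x₀‖ * ‖a‖ ^ 2 / ‖y - x₀‖ ^ 4)
    {ν : ℝ} {u₀ : EuclideanSpace ℝ (Fin 3) → EuclideanSpace ℝ (Fin 3)}
    {v : ℝ → EuclideanSpace ℝ (Fin 3) → EuclideanSpace ℝ (Fin 3)}
    {π : ℝ → EuclideanSpace ℝ (Fin 3) → ℝ} (hv : IsLocalLeraySolution ν u₀ v π)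
    {T : ℝ} (x₀ : EuclideanSpace ℝ (Fin 3))
    {c : ℝ → ℝ} (hcm : AEStronglyMeasurable c (volume.restrict (Ioo 0 T)))
    (hdec : ∀ᵐ z ∂(volume.restrict (Ioo 0 T ×ˢ ball x₀ (3 / 2))),
      π z.1 z.2 - c z.1 =
        localPressureNear x₀ (3 / 2) v z.1 z.2 + localPressureFar x₀ (3 / 2) v z.1 z.2)
    {A : ℝ≥0} (hA : ∀ᵐ t ∂(volume.restrict (Ioo 0 T)), ∀ z : EuclideanSpace ℝ (Fin 3),
      ∫⁻ y in ball z 1, ‖v t y‖ₑ ^ 2 ≤ A)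
    {ρ : ℝ} (hρ : 3 ≤ ρ)
    {A₁ : ℝ≥0} (hA₁ : ∀ᵐ t ∂(volume.restrict (Ioo 0 T)),
      ∫⁻ y in ball x₀ ρ, ‖v t y‖ₑ ^ 2 ≤ A₁) :
    ∫⁻ z in Ioo 0 T ×ˢ ball x₀ (3 / 2), ‖π z.1 z.2 - c z.1‖ₑ ^ (3 / 2 : ℝ) ≤
      (2 : ℝ≥0∞) ^ (1 / 2 : ℝ) * Cn *
          (∫⁻ z in Ioo 0 T ×ˢ ball x₀ (2 * (3 / 2)), ‖v z.1 z.2‖ₑ ^ (3 : ℕ)) +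
        (2 : ℝ≥0∞) ^ (1 / 2 : ℝ) * volume (ball (0 : EuclideanSpace ℝ (Fin 3)) (3 / 2)) *
          ENNReal.ofReal (CK * (3 / 2)) ^ (3 / 2 : ℝ) * (2 : ℝ≥0∞) ^ (1 / 2 : ℝ) *
          ((ENNReal.ofReal ((2 * (3 / 2)) ^ (-(4 : ℝ))) * A₁) ^ (1 / 2 : ℝ) *
            ENNReal.ofReal ((2 * (3 / 2)) ^ (-(4 : ℝ)))) *
          (∫⁻ z in Ioo 0 T ×ˢ ball x₀ ρ, ‖v z.1 z.2‖ₑ ^ 2) +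
        (2 : ℝ≥0∞) ^ (1 / 2 : ℝ) * volume (ball (0 : EuclideanSpace ℝ (Fin 3)) (3 / 2)) *
          ENNReal.ofReal (CK * (3 / 2)) ^ (3 / 2 : ℝ) * (2 : ℝ≥0∞) ^ (1 / 2 : ℝ) *
          ((volume (ball (0 : EuclideanSpace ℝ (Fin 3)) 1))⁻¹ *
            (A * (16 * ∫⁻ z in (ball (0 : EuclideanSpace ℝ (Fin 3)) (ρ - 1))ᶜ,
              RieszKernel.powKer 4 z))) ^ (3 / 2 : ℝ) *
          volume (Ioo (0 : ℝ) T) := by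
  -- ## names (`r = 3/2`, `2r = 3`; kept literal)
  set G₃ : ℝ≥0∞ := ∫⁻ z in Ioo 0 T ×ˢ ball x₀ (2 * (3 / 2)), ‖v z.1 z.2‖ₑ ^ (3 : ℕ)
    with hG₃def
  set E₂ : ℝ≥0∞ := ∫⁻ z in Ioo 0 T ×ˢ ball x₀ ρ, ‖v z.1 z.2‖ₑ ^ 2 with hE₂def
  have hrpos : (0 : ℝ) < 3 / 2 := by norm_num
  have h2r : (0 : ℝ) < 2 * (3 / 2) := by norm_num
  set B : Set (EuclideanSpace ℝ (Fin 3)) := ball x₀ (3 / 2) with hB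
  set N := localPressureNear x₀ (3 / 2) v with hN
  set Fa := localPressureFar x₀ (3 / 2) v with hFa
  set μt : Measure ℝ := volume.restrict (Ioo 0 T) with hμt
  set μB : Measure (EuclideanSpace ℝ (Fin 3)) := volume.restrict B with hμB
  set s2 : ℝ≥0∞ := (2 : ℝ≥0∞) ^ (1 / 2 : ℝ) with hs2
  set VB : ℝ≥0∞ := volume (ball (0 : EuclideanSpace ℝ (Fin 3)) (3 / 2)) with hVB
  set k₁ : ℝ≥0∞ := ENNReal.ofReal ((2 * (3 / 2 : ℝ)) ^ (-(4 : ℝ))) with hk₁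
  set cK : ℝ≥0∞ := ENNReal.ofReal (CK * (3 / 2)) with hcK
  set Tail : ℝ≥0∞ := (volume (ball (0 : EuclideanSpace ℝ (Fin 3)) 1))⁻¹ *
    (A * (16 * ∫⁻ z in (ball (0 : EuclideanSpace ℝ (Fin 3)) (ρ - 1))ᶜ,
      RieszKernel.powKer 4 z)) with hTail
  set α : ℝ≥0∞ := s2 * Cn with hα
  set β : ℝ≥0∞ := s2 * VB * cK ^ (3 / 2 : ℝ) * s2 * ((k₁ * A₁) ^ (1 / 2 : ℝ) * k₁) with hβ
  set γ : ℝ≥0∞ := s2 * VB * cK ^ (3 / 2 : ℝ) * s2 * Tail ^ (3 / 2 : ℝ) with hγ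
  -- slice functionals
  set g₃ : ℝ → ℝ≥0∞ := fun t => ∫⁻ x in ball x₀ (2 * (3 / 2)), ‖v t x‖ₑ ^ (3 : ℕ) with hg₃
  set e : ℝ → ℝ≥0∞ := fun t => ∫⁻ x in ball x₀ ρ, ‖v t x‖ₑ ^ 2 with he
  set far : ℝ → ℝ≥0∞ := fun t =>
    ∫⁻ y in (ball x₀ (2 * (3 / 2)))ᶜ, ‖v t y‖ₑ ^ (2 : ℕ) * RieszKernel.powKer 4 (y - x₀) with hfar
  show ∫⁻ z in Ioo 0 T ×ˢ B, ‖π z.1 z.2 - c z.1‖ₑ ^ (3 / 2 : ℝ) ≤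
    α * G₃ + β * E₂ + γ * volume (Ioo (0 : ℝ) T)
  -- ## finiteness of the constants
  have hs2top : s2 ≠ ⊤ := ENNReal.rpow_ne_top_of_nonneg (by norm_num) ENNReal.ofNat_ne_top
  have hVBtop : VB ≠ ⊤ := measure_ball_lt_top.ne
  have hk₁top : k₁ ≠ ⊤ := ENNReal.ofReal_ne_top
  have hcKtop : cK ≠ ⊤ := ENNReal.ofReal_ne_top
  have hαtop : α ≠ ⊤ := ENNReal.mul_ne_top hs2top hCntop
  have hα0 : α ≠ 0 := mul_ne_zero (ENNReal.rpow_pos (by norm_num) ENNReal.ofNat_ne_top).ne' hCn0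
  -- ## measurability on the slab and on the boxes
  have hvm : AEStronglyMeasurable (uncurry v)
      (volume.restrict (Ioi (0 : ℝ) ×ˢ (univ : Set (EuclideanSpace ℝ (Fin 3))))) :=
    hv.aestronglyMeasurable
  have hπm := hv.aestronglyMeasurable_pressure
  have hbox : ∀ S : Set (EuclideanSpace ℝ (Fin 3)),
      μt.prod (volume.restrict S) = volume.restrict (Ioo 0 T ×ˢ S) := fun S => by
    rw [hμt, Measure.prod_restrict, ← Measure.volume_eq_prod]
  have hsub : ∀ S : Set (EuclideanSpace ℝ (Fin 3)),
      Ioo 0 T ×ˢ S ⊆ Ioi (0 : ℝ) ×ˢ (univ : Set (EuclideanSpace ℝ (Fin 3))) := fun S =>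
    Set.prod_mono Ioo_subset_Ioi_self (subset_univ _)
  have hvmS : ∀ S : Set (EuclideanSpace ℝ (Fin 3)),
      AEStronglyMeasurable (uncurry v) (μt.prod (volume.restrict S)) := fun S => by
    rw [hbox]
    exact hvm.mono_measure (Measure.restrict_mono (hsub S) le_rfl)
  have hF : ∀ (S : Set (EuclideanSpace ℝ (Fin 3))) (n : ℕ),
      AEMeasurable (fun z : ℝ × EuclideanSpace ℝ (Fin 3) => ‖v z.1 z.2‖ₑ ^ n)
        (μt.prod (volume.restrict S)) := fun S n => (hvmS S).enorm.pow_const n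
  have hg₃m : AEMeasurable g₃ μt := (hF (ball x₀ (2 * (3 / 2))) 3).lintegral_prod_right'
  have hem : AEMeasurable e μt := (hF (ball x₀ ρ) 2).lintegral_prod_right'
  -- Tonelli for the three space-time functionals
  have hT3 : G₃ = ∫⁻ t, g₃ t ∂μt := by
    rw [hG₃def, ← hbox, lintegral_prod _ (hF _ 3)]
  have hT2 : E₂ = ∫⁻ t, e t ∂μt := by
    rw [hE₂def, ← hbox, lintegral_prod _ (hF _ 2)]
  have hGm : AEStronglyMeasurable (fun z : ℝ × EuclideanSpace ℝ (Fin 3) => π z.1 z.2 - c z.1)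
      (μt.prod μB) := by
    refine AEStronglyMeasurable.sub ?_ ?_
    · rw [hμB, hbox]
      exact hπm.mono_measure (Measure.restrict_mono (hsub B) le_rfl)
    · exact hcm.comp_fst
  have hTI : ∫⁻ z in Ioo 0 T ×ˢ B, ‖π z.1 z.2 - c z.1‖ₑ ^ (3 / 2 : ℝ) =
      ∫⁻ t, ∫⁻ x, ‖π t x - c t‖ₑ ^ (3 / 2 : ℝ) ∂μB ∂μt := by
    rw [← hbox B, ← hμB, lintegral_prod _ (hGm.enorm.pow_const _)]
  -- ## the case `G₃ = ∞`
  by_cases hG₃ : G₃ = ⊤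
  · rw [hG₃, ENNReal.mul_top hα0, top_add, top_add]
    exact le_top
  -- ## a.e. in `t`: slice facts
  have hslice_meas := hv.ae_aestronglyMeasurable_slice T
  have hfin : ∀ᵐ t ∂μt, g₃ t < ⊤ := by
    refine ae_lt_top' hg₃m ?_
    rw [← hT3]
    exact hG₃
  have hdec' : ∀ᵐ t ∂μt, ∀ᵐ x ∂μB, π t x - c t = N t x + Fa t x := by
    have h1 : ∀ᵐ z ∂μt.prod μB, π z.1 z.2 - c z.1 = N z.1 z.2 + Fa z.1 z.2 := by
      rw [hμB, hbox]
      exact hdec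
    exact Measure.ae_ae_of_ae_prod h1
  -- ## the slice estimate
  have hinner : ∀ᵐ t ∂μt, ∫⁻ x, ‖π t x - c t‖ₑ ^ (3 / 2 : ℝ) ∂μB ≤
      α * g₃ t + β * e t + γ := by
    filter_upwards [hslice_meas, hfin, hdec', hA, hA₁] with t hmt hft hdt hAt hA₁t
    -- the far field at time `t`
    have hfar_split : far t ≤ k₁ * e t + Tail := by
      have hS : (ball x₀ (2 * (3 / 2)))ᶜ ⊆ (ball x₀ ρ ∩ (ball x₀ (2 * (3 / 2)))ᶜ) ∪ (ball x₀ ρ)ᶜ := by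
        intro y hy
        by_cases hyρ : y ∈ ball x₀ ρ
        · exact Or.inl ⟨hyρ, hy⟩
        · exact Or.inr hyρ
      have h1 : ∫⁻ y in ball x₀ ρ ∩ (ball x₀ (2 * (3 / 2)))ᶜ,
          ‖v t y‖ₑ ^ (2 : ℕ) * RieszKernel.powKer 4 (y - x₀) ≤ k₁ * e t := by
        calc ∫⁻ y in ball x₀ ρ ∩ (ball x₀ (2 * (3 / 2)))ᶜ,
              ‖v t y‖ₑ ^ (2 : ℕ) * RieszKernel.powKer 4 (y - x₀)
            ≤ ∫⁻ y in ball x₀ ρ ∩ (ball x₀ (2 * (3 / 2)))ᶜ, ‖v t y‖ₑ ^ (2 : ℕ) * k₁ := by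
              refine setLIntegral_mono' (measurableSet_ball.inter measurableSet_ball.compl)
                fun y hy => ?_
              refine mul_le_mul' le_rfl ?_
              have hy2 : 2 * (3 / 2 : ℝ) ≤ ‖y - x₀‖ := by
                have := hy.2
                rw [mem_compl_iff, mem_ball, dist_eq_norm, not_lt] at this
                exact this
              exact RieszKernel.powKer_le_const (by norm_num) h2r hy2
          _ = (∫⁻ y in ball x₀ ρ ∩ (ball x₀ (2 * (3 / 2)))ᶜ, ‖v t y‖ₑ ^ (2 : ℕ)) * k₁ :=
              lintegral_mul_const' _ _ hk₁top
          _ ≤ e t * k₁ := by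
              gcongr
              exact lintegral_mono_set inter_subset_left
          _ = k₁ * e t := mul_comm _ _
      have h2 : ∫⁻ y in (ball x₀ ρ)ᶜ, ‖v t y‖ₑ ^ (2 : ℕ) * RieszKernel.powKer 4 (y - x₀) ≤
          Tail :=
        lintegral_compl_ball_mul_powKer_le (hmt.enorm.pow_const _) hAt x₀ (by linarith)
      calc far t ≤ ∫⁻ y in (ball x₀ ρ ∩ (ball x₀ (2 * (3 / 2)))ᶜ) ∪ (ball x₀ ρ)ᶜ,
            ‖v t y‖ₑ ^ (2 : ℕ) * RieszKernel.powKer 4 (y - x₀) := lintegral_mono_set hS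
        _ ≤ _ := lintegral_union_le _ _ _
        _ ≤ k₁ * e t + Tail := add_le_add h1 h2
    -- the far field bounds `π_far` on `B`
    have hFaB : ∀ x ∈ B, ‖Fa t x‖ₑ ≤ cK * far t := fun x hx =>
      enorm_localPressureFar_le hCK0 hCK x₀ hrpos v t hx
    -- `(cK far)^{3/2} ≤ cK^{3/2} √2 ((k₁ A₁)^{1/2} k₁ e + Tail^{3/2})`
    have hM : (cK * far t) ^ (3 / 2 : ℝ) ≤
        cK ^ (3 / 2 : ℝ) * (s2 * ((k₁ * A₁) ^ (1 / 2 : ℝ) * k₁ * e t + Tail ^ (3 / 2 : ℝ))) := by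
      rw [ENNReal.mul_rpow_of_nonneg _ _ (by norm_num)]
      refine mul_le_mul' le_rfl ?_
      calc far t ^ (3 / 2 : ℝ) ≤ (k₁ * e t + Tail) ^ (3 / 2 : ℝ) :=
            ENNReal.rpow_le_rpow hfar_split (by norm_num)
        _ ≤ s2 * ((k₁ * e t) ^ (3 / 2 : ℝ) + Tail ^ (3 / 2 : ℝ)) := add_rpow_threeHalves_le _ _
        _ ≤ s2 * ((k₁ * A₁) ^ (1 / 2 : ℝ) * k₁ * e t + Tail ^ (3 / 2 : ℝ)) := by
            gcongr s2 * (?_ + _)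
            rw [rpow_threeHalves_eq_sqrt_mul, mul_assoc]
            gcongr
    -- the near field at time `t`
    have hNt : ∫⁻ x, ‖N t x‖ₑ ^ (3 / 2 : ℝ) ∂μB ≤ Cn * g₃ t :=
      (lintegral_mono' Measure.restrict_le_self le_rfl).trans
        (hnear x₀ (3 / 2) v t hmt hft.ne)
    -- assemble on the slice
    calc ∫⁻ x, ‖π t x - c t‖ₑ ^ (3 / 2 : ℝ) ∂μB
        = ∫⁻ x, ‖N t x + Fa t x‖ₑ ^ (3 / 2 : ℝ) ∂μB := by
          refine lintegral_congr_ae ?_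
          filter_upwards [hdt] with x hx
          rw [hx]
      _ ≤ ∫⁻ x, (‖N t x‖ₑ + cK * far t) ^ (3 / 2 : ℝ) ∂μB := by
          rw [hμB]
          refine setLIntegral_mono' measurableSet_ball fun x hx => ?_
          exact ENNReal.rpow_le_rpow ((enorm_add_le _ _).trans
            (add_le_add le_rfl (hFaB x hx))) (by norm_num)
      _ ≤ ∫⁻ x, s2 * (‖N t x‖ₑ ^ (3 / 2 : ℝ) + (cK * far t) ^ (3 / 2 : ℝ)) ∂μB :=
          lintegral_mono fun x => add_rpow_threeHalves_le _ _
      _ = s2 * (∫⁻ x, ‖N t x‖ₑ ^ (3 / 2 : ℝ) ∂μB + (cK * far t) ^ (3 / 2 : ℝ) * volume B) := by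
          rw [lintegral_const_mul' _ _ hs2top, lintegral_add_right' _ aemeasurable_const,
            lintegral_const, hμB, Measure.restrict_apply_univ]
      _ ≤ s2 * (Cn * g₃ t + cK ^ (3 / 2 : ℝ) *
            (s2 * ((k₁ * A₁) ^ (1 / 2 : ℝ) * k₁ * e t + Tail ^ (3 / 2 : ℝ))) * VB) := by
          rw [hB, Measure.addHaar_ball_center volume x₀ (3 / 2)]
          gcongr
      _ = α * g₃ t + β * e t + γ * 1 := by
          rw [hα, hβ, hγ]
          ring
      _ = α * g₃ t + β * e t + γ := by rw [mul_one]
  -- ## integrate in time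
  calc ∫⁻ z in Ioo 0 T ×ˢ B, ‖π z.1 z.2 - c z.1‖ₑ ^ (3 / 2 : ℝ)
      = ∫⁻ t, ∫⁻ x, ‖π t x - c t‖ₑ ^ (3 / 2 : ℝ) ∂μB ∂μt := hTI
    _ ≤ ∫⁻ t, (α * g₃ t + β * e t + γ) ∂μt := lintegral_mono_ae hinner
    _ = α * ∫⁻ t, g₃ t ∂μt + β * ∫⁻ t, e t ∂μt + γ * μt univ := by
        have hm1 : AEMeasurable (fun t => α * g₃ t) μt := hg₃m.const_mul α
        have hm2 : AEMeasurable (fun t => β * e t) μt := hem.const_mul β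
        calc ∫⁻ t, (α * g₃ t + β * e t + γ) ∂μt
            = ∫⁻ t, α * g₃ t ∂μt + ∫⁻ t, (β * e t + γ) ∂μt := by
              rw [← lintegral_add_left' hm1]
              simp only [add_assoc]
          _ = ∫⁻ t, α * g₃ t ∂μt + (∫⁻ t, β * e t ∂μt + ∫⁻ _, γ ∂μt) := by
              rw [← lintegral_add_left' hm2]
          _ = α * ∫⁻ t, g₃ t ∂μt + β * ∫⁻ t, e t ∂μt + γ * μt univ := by
              rw [lintegral_const_mul'' _ hg₃m, lintegral_const_mul'' _ hem, lintegral_const,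
                add_assoc]
    _ = α * G₃ + β * E₂ + γ * volume (Ioo (0 : ℝ) T) := by
        rw [hT3, hT2]
        congr 1
        rw [hμt, Measure.restrict_apply_univ]

/-! ## Dp from PD and CZ; F from ε-regularity, PD and CZ -/

/-- **The Kikuchi–Seregin decay of the gauged pressure (`leray_solution_pressure_decay`, Dp)
from the local pressure expansion (PD, Kang–Miura–Tsai 2021 Lemma 3.4) and Stein's `L^p` bound
for the Riesz-transform pressure (CZ).** See the module docstring for the proof (gauge by ball
averages; near field by CZ and the decay of `∫∫|v|³`; far field by the two-centre kernel
bound, the uniformly local energy (2) and the decay (7); `ε/3` argument).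
[cite: KangMiuraTsai2020, Lemma 3.3 (= Kikuchi–Seregin 2007 Lemma 2.2, the δ_R term) with Lemma 3.4, arXiv:1812.10509 pp. 7–8] -/
theorem leray_solution_pressure_decay_of_decomposition
    (hPD : kangMiuraTsai_pressure_decomposition)
    (hCZ : stein1970_normalisedPressure_ae_Lp_bound) : leray_solution_pressure_decay := by
  intro u₀ h3 hdiv v π hv
  have hE2 : MemE2 u₀ := memE2_of_memLp h3 (by norm_num) ENNReal.ofNat_ne_top
  have hr : (0 : ℝ) < 3 / 2 := by norm_num
  choose c hc using fun x₀ : EuclideanSpace ℝ (Fin 3) =>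
    exists_gauge_of_pressure_decomposition hPD hE2 hdiv hv x₀ hr
  refine ⟨c, fun x₀ T hT => (hc x₀ T hT).1, fun T hT => ?_⟩
  -- ## constants
  obtain ⟨Cn, hCn0, hCntop, hnear⟩ := exists_lintegral_localPressureNear_le hCZ
  obtain ⟨CK, hCK0, hCK⟩ := exists_abs_pressureKernel_sub_le
  obtain ⟨A, hA⟩ := hv.exists_ae_lintegral_ball_le T 1
  set s2 : ℝ≥0∞ := (2 : ℝ≥0∞) ^ (1 / 2 : ℝ) with hs2
  set VB : ℝ≥0∞ := volume (ball (0 : EuclideanSpace ℝ (Fin 3)) (3 / 2)) with hVB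
  set k₁ : ℝ≥0∞ := ENNReal.ofReal ((2 * (3 / 2 : ℝ)) ^ (-(4 : ℝ))) with hk₁
  set cK : ℝ≥0∞ := ENNReal.ofReal (CK * (3 / 2)) with hcK
  set V1 : ℝ≥0∞ := volume (ball (0 : EuclideanSpace ℝ (Fin 3)) 1) with hV1
  set Φ : ℝ → ℝ≥0∞ := fun s =>
    ∫⁻ z in (ball (0 : EuclideanSpace ℝ (Fin 3)) s)ᶜ, RieszKernel.powKer 4 z with hΦ
  set Tail : ℝ → ℝ≥0∞ := fun ρ => V1⁻¹ * (A * (16 * Φ (ρ - 1))) with hTail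
  set γ : ℝ → ℝ≥0∞ := fun ρ => s2 * VB * cK ^ (3 / 2 : ℝ) * s2 * Tail ρ ^ (3 / 2 : ℝ) with hγ
  set G₃ : EuclideanSpace ℝ (Fin 3) → ℝ≥0∞ := fun x₀ =>
    ∫⁻ z in Ioo 0 T ×ˢ ball x₀ (2 * (3 / 2)), ‖v z.1 z.2‖ₑ ^ (3 : ℕ) with hG₃
  set E₂ : ℝ → EuclideanSpace ℝ (Fin 3) → ℝ≥0∞ := fun ρ x₀ =>
    ∫⁻ z in Ioo 0 T ×ˢ ball x₀ ρ, ‖v z.1 z.2‖ₑ ^ 2 with hE₂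
  have hs2top : s2 ≠ ⊤ := ENNReal.rpow_ne_top_of_nonneg (by norm_num) ENNReal.ofNat_ne_top
  have hVBtop : VB ≠ ⊤ := measure_ball_lt_top.ne
  have hk₁top : k₁ ≠ ⊤ := ENNReal.ofReal_ne_top
  have hcKtop : cK ≠ ⊤ := ENNReal.ofReal_ne_top
  have hV10 : V1 ≠ 0 := (measure_ball_pos volume _ one_pos).ne'
  have hV1inv : V1⁻¹ ≠ ⊤ := ENNReal.inv_ne_top.2 hV10
  have hvolT : volume (Ioo (0 : ℝ) T) ≠ ⊤ := by
    rw [Real.volume_Ioo]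
    exact ENNReal.ofReal_ne_top
  -- ## `γ ρ → 0` as `ρ → ∞`
  have hΦ0 : Tendsto (fun ρ : ℝ => Φ (ρ - 1)) atTop (𝓝 0) := by
    have h1 : Tendsto (fun ρ : ℝ => ρ - 1) atTop atTop :=
      tendsto_atTop_atTop.2 fun b => ⟨b + 1, fun a ha => by linarith⟩
    exact tendsto_lintegral_compl_ball_powKer_four_atTop.comp h1
  have hTail0 : Tendsto Tail atTop (𝓝 0) := by
    have h1 := ENNReal.Tendsto.const_mul hΦ0 (Or.inr (by norm_num : (16 : ℝ≥0∞) ≠ ⊤))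
    have h2 := ENNReal.Tendsto.const_mul h1 (Or.inr (ENNReal.coe_ne_top (r := A)))
    have h3 := ENNReal.Tendsto.const_mul h2 (Or.inr hV1inv)
    simpa only [mul_zero] using h3
  have hcK32 : cK ^ (3 / 2 : ℝ) ≠ ⊤ := ENNReal.rpow_ne_top_of_nonneg (by norm_num) hcKtop
  have hconst : s2 * VB * cK ^ (3 / 2 : ℝ) * s2 ≠ ⊤ :=
    ENNReal.mul_ne_top (ENNReal.mul_ne_top (ENNReal.mul_ne_top hs2top hVBtop) hcK32) hs2top
  have hγ0 : Tendsto (fun ρ => γ ρ * volume (Ioo (0 : ℝ) T)) atTop (𝓝 0) := by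
    have h1 : Tendsto (fun ρ => Tail ρ ^ (3 / 2 : ℝ)) atTop (𝓝 0) := by
      have := ((ENNReal.continuous_rpow_const (y := (3 / 2 : ℝ))).tendsto 0).comp hTail0
      rwa [ENNReal.zero_rpow_of_pos (by norm_num : (0 : ℝ) < 3 / 2)] at this
    have h2 := ENNReal.Tendsto.const_mul h1 (Or.inr hconst)
    rw [mul_zero] at h2
    have h3 := ENNReal.Tendsto.mul_const h2 (Or.inr hvolT)
    rwa [zero_mul] at h3
  -- ## the `ε/3` argument
  rw [ENNReal.tendsto_nhds_zero]
  intro ε hε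
  have hε3 : 0 < ε / 3 := ENNReal.div_pos hε.ne' ENNReal.ofNat_ne_top
  obtain ⟨ρ, hρ3, hγρ⟩ : ∃ ρ : ℝ, 3 ≤ ρ ∧ γ ρ * volume (Ioo (0 : ℝ) T) ≤ ε / 3 :=
    ((eventually_ge_atTop (3 : ℝ)).and (ENNReal.tendsto_nhds_zero.1 hγ0 _ hε3)).exists
  obtain ⟨A₁, hA₁⟩ := hv.exists_ae_lintegral_ball_le T ρ
  set β : ℝ≥0∞ := s2 * VB * cK ^ (3 / 2 : ℝ) * s2 * ((k₁ * A₁) ^ (1 / 2 : ℝ) * k₁) with hβ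
  have hkA : (k₁ * A₁) ^ (1 / 2 : ℝ) ≠ ⊤ :=
    ENNReal.rpow_ne_top_of_nonneg (by norm_num) (ENNReal.mul_ne_top hk₁top ENNReal.coe_ne_top)
  have hβtop : β ≠ ⊤ := ENNReal.mul_ne_top hconst (ENNReal.mul_ne_top hkA hk₁top)
  -- the two decays in `x₀`
  have hG₃0 : Tendsto G₃ (cocompact (EuclideanSpace ℝ (Fin 3))) (𝓝 0) :=
    hv.tendsto_lintegral_cube_cocompact (2 * (3 / 2)) T
  have hE₂0 : Tendsto (E₂ ρ) (cocompact (EuclideanSpace ℝ (Fin 3))) (𝓝 0) := by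
    set R : ℝ := max ρ (max T 1) with hR
    have hR1 : 1 ≤ R := le_trans (le_max_right T 1) (le_max_right _ _)
    have hRpos : 0 < R := by linarith
    have hρR : ρ ≤ R := le_max_left _ _
    have hTR : T ≤ R ^ 2 := by
      nlinarith [le_trans (le_max_left T 1) (le_max_right ρ (max T 1))]
    refine tendsto_of_tendsto_of_tendsto_of_le_of_le tendsto_const_nhds (hv.decay R hRpos)
      (fun _ => zero_le) fun x₀ => ?_
    exact lintegral_mono_set (Set.prod_mono (Ioo_subset_Ioo le_rfl hTR) (ball_subset_ball hρR))
  have h1 : ∀ᶠ x₀ in cocompact (EuclideanSpace ℝ (Fin 3)), s2 * Cn * G₃ x₀ ≤ ε / 3 := by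
    have h := ENNReal.Tendsto.const_mul hG₃0 (Or.inr (ENNReal.mul_ne_top hs2top hCntop))
    rw [mul_zero] at h
    exact ENNReal.tendsto_nhds_zero.1 h _ hε3
  have h2 : ∀ᶠ x₀ in cocompact (EuclideanSpace ℝ (Fin 3)), β * E₂ ρ x₀ ≤ ε / 3 := by
    have h := ENNReal.Tendsto.const_mul hE₂0 (Or.inr hβtop)
    rw [mul_zero] at h
    exact ENNReal.tendsto_nhds_zero.1 h _ hε3
  filter_upwards [h1, h2] with x₀ hx1 hx2
  have hkey := lintegral_gauged_pressure_le hCn0 hCntop hnear hCK0 hCK hv x₀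
    (hc x₀ T hT).1.aestronglyMeasurable (hc x₀ T hT).2 hA hρ3
    (hA₁.mono fun t ht => ht x₀)
  calc ∫⁻ z in Ioo 0 T ×ˢ ball x₀ (3 / 2), ‖π z.1 z.2 - c x₀ z.1‖ₑ ^ (3 / 2 : ℝ)
      ≤ s2 * Cn * G₃ x₀ + β * E₂ ρ x₀ + γ ρ * volume (Ioo (0 : ℝ) T) := hkey
    _ ≤ ε / 3 + ε / 3 + ε / 3 := add_le_add_three hx1 hx2 hγρ
    _ = ε := ENNReal.add_thirds ε

/-- **Far-field regularity of local Leray solutions (F) from Lemarié-Rieusset's ε-regularity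
criterion (Thm. 14.4), the local pressure expansion of Kang–Miura–Tsai (Lemma 3.4) and Stein's
`L^p` bound for the Riesz transforms (Ch. II Thms. 3–4)** — the tree's
`leray_solution_farField_bound_of_pressure_decay` with
`leray_solution_pressure_decay_of_decomposition` (Bradshaw–Tsai 2020, end of §1: far-field
regularity "using [the ε-regularity criterion] and the decay
`lim_{|x₀|→∞} ∫₀ᵀ∫_{B_1(x₀)} |u|³ + |p - c_{x₀,1}(t)|^{3/2} dx dt = 0`").
[cite: BradshawTsai2020, §1 p. 7 (arXiv:1907.00256, far-field regularity)] -/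
theorem leray_solution_farField_bound_of_decomposition
    (hε : lemarieRieusset_epsilon_regularity) (hPD : kangMiuraTsai_pressure_decomposition)
    (hCZ : stein1970_normalisedPressure_ae_Lp_bound) : leray_solution_farField_bound :=
  leray_solution_farField_bound_of_pressure_decay hε
    (leray_solution_pressure_decay_of_decomposition hPD hCZ)

/-! ## The bridge between the two Stein facts -/

/-- **CZ on the `L^p` class implies CZ on the smooth class**: the tree's
`stein1970_normalisedPressure_Lp_bound` (`NormalisedPressureLpBound.lean`, `w ∈ C^∞_c`) from
`stein1970_normalisedPressure_ae_Lp_bound` (a smooth compactly supported `w` is measurable with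
`|w|² ∈ L^p`). [cite: Stein1971, Ch. II §4.2 Thm 3 (b)] -/
theorem stein1970_normalisedPressure_Lp_bound_of_ae (h : stein1970_normalisedPressure_ae_Lp_bound) :
    stein1970_normalisedPressure_Lp_bound := by
  intro p hp1 hp2
  obtain ⟨C, hC⟩ := h p hp1 hp2
  refine ⟨C, fun w hw hwc => (hC w hw.continuous.aestronglyMeasurable ?_).2⟩
  have hc : Continuous fun x => ‖w x‖ ^ 2 := (continuous_norm.comp hw.continuous).pow 2
  have hs : HasCompactSupport fun x => ‖w x‖ ^ 2 :=
    hwc.comp_left (g := fun a : EuclideanSpace ℝ (Fin 3) => ‖a‖ ^ 2) (by simp)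
  exact hc.memLp_of_hasCompactSupport hs

end Literature.Analysis.FluidPDE
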